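import Summits.HodgeConjecture.HodgeConjecture.Theorems.R90S6TreeFixDataCosetShellsU3   -- ★ GF1 FILE 2a (K2Liu-p14): §3 `ncard_displaced_two_add_eq_of_natCard_fixedBy_eq`, §4 `ncard_selfDual_displaced_add_eq_of_natCard_fixedBy_eq`
import Summits.HodgeConjecture.HodgeConjecture.Theorems.R90S6FlickerLiteralCounts      -- ★ F0P2-p09 §3 FILE B: `flickerFrame_natCard_fixedBy_one_of_separated` (t₁ ↦ (1,0)), `…_pi_of_separated` (t_ϖ ↦ (0,1))
import HarnessLib

/-!
# R90 · S6 «Ch. 14.1–14.5 stable trace formula» — card GF1 FILE 2b, SEPARATED BLOCK: THE DISPLACEMENT SHELLS OF FLICKER'S FOUR LITERALS IN REGIME R-III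
# (`|a−b| = |a−c| = |b−c| = 1`): `N′(t₁) = (0, q³+1)`, `N′(t_ϖ) = (q+1, 0)`, `S′_k(t₁) = [k even]·q^{2k−3}(q³+1)`, `S′_k(t_ϖ) = [k odd]·q^{2(k−1)}(q+1)`
# (`Theorems/R90S6TreeFixDataFlickerU3Separated.lean`)

Cell `hodgecm-mathlib`, crux H413 (`stmt-HodgeConjecture-24833`), route of record `HCCMUnconditional`; programme R90-TF (brief `director/R90-BRIEF.v2.md`
1f40d54518340a35), section S6 (base `R90-C14`, dealer R90-C14-plan (g2)), seat R90-C14-p10 (g2); card GF1 FILE 2 CO-PEN (cut K2Liu-p14 (g5) 02:49:55Z: 2b = per-literal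
values; land order «Separated first»).  Lane `--kind proof --supports stmt-HodgeConjecture-24833 --as helper`; THEOREMS ONLY (no definition, no instance, no notation, no named
fact, no kit, no `sorry`); imports = ★ 2a `Theorems/R90S6TreeFixDataCosetShellsU3` + ★ F0P2-p09 `Theorems/R90S6FlickerLiteralCounts` + HarnessLib (never `Lines/`).

THE MATHEMATICS ((E1) sheet v1.1 b34a1458, hand checks (ii)–(iii); [Flicker1998UnitaryFL] §2 Prop. 3, §6; [Rogawski1990] §4.9 Prop. 4.9.1 (b); [Serre1980Trees] I.6.4).
In the RESIDUALLY SEPARATED regime R-III (the three norm-one eigenvalues `a, b, c` pairwise residually distinct) the fixed-vertex data of Flicker's literals on the `U(2,1)`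
tree `X₃` are `(V_hyp, V_sp)(t₁) = (1, 0)` (`t₁ = t_1(a,b,c) ∈ K₀` fixes the root and nothing else) and `(V_hyp, V_sp)(t_ϖ) = (0, 1)` (`t_ϖ(a,b,c)` fixes the special vertex
`w₀·N₁` and nothing else) — ★ F0P2-p09 `flickerFrame_natCard_fixedBy_one∕pi_of_separated`.  Plugged into ★ 2a's shell identities
(`N′_sp + (V₀+V₁) = (q³+1)V₀ + 1`, `N′_hyp + (V₀+V₁) = (q+1)V₁ + 1`, and the ★ G3-NUMBERS growth law for `S′_k`) this gives, per literal, the CLOSED first shells and ALL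
hyperspecial displacement shells `S′_k = #{x hyperspecial : d(x, t x) = 2k}` = ★ A1's `O_t(1_{K₀ t^k K₀}) ∕ ν(K₀)`:
* §1 `t₁`: **`flickerFix_ncard_displaced_two_tOne_separated`** `(N′_sp, N′_hyp)(t₁) = (q³ + 1, 0)`; **`flickerFix_ncard_selfDual_displaced_tOne_separated`**
  `S′_k(t₁) = q^{2k−3}(q³+1)` for `k` even, `0` for `k` odd (`k ≥ 1`; hand check (iii): `S′₂(t₁) = (q³+1)q`).
* §2 `t_ϖ(a,b,c)` (= `t₂`; `t₃ = t_ϖ(a,c,b)`, `t₄ = t_ϖ(b,a,c)` in §3 by relabelling, R-III being symmetric in `a, b, c`):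
  **`flickerFix_ncard_displaced_two_tpi_separated`** `(N′_sp, N′_hyp)(t_ϖ) = (0, q + 1)`; **`flickerFix_ncard_selfDual_displaced_tpi_separated`** `S′_k(t_ϖ) = 0` for `k` even,
  `q^{2(k−1)}(q+1)` for `k` odd (hand check (ii): `S′₁ = q+1`; (iii): `S′₂ = 0`).
* `t₃`, `t₄` (the (E1) sheet's `hγ₃`, `hγ₄` bytes) ARE §2 with the letters `(a, b, c)` permuted to `(a, c, b)`, `(b, a, c)` — regime R-III is symmetric; the consumer
  instantiates (`|c − b| = |b − c|` by `Valuation.map_sub_swap`).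
Binders = ★ 2a §3's (`hd hσO σk hσk hq hfrob g₁ hg₁ γ [Fintype] hK₁fin horb c hc0`) ∪ ★ F0P2-p09's (`r hr [∀ x, Finite …] h2 h2e ha hb hc hab hac hbc hγ`), VERBATIM.
HONEST LABEL: per-literal value bookkeeping (composition of ★ files), count-neutral until (E1) consumes it; proves no printed global statement, discharges no citation; HC_CM is
proved only modulo the 7 printed citations (2 remaining named inputs: hLiu418 = stmt-HodgeConjecture-24832, h413 = stmt-HodgeConjecture-24833) until rung 0 closes.  REL ≠ ★ ≠ BUILT.

## References
* [Flicker1998UnitaryFL] Y. Z. Flicker, *Elementary proof of the fundamental lemma for a unitary group*, Canad. J. Math. 50 (1998): §2 Prop. 3 pp. 78–79, §3 p. 80, §6 p. 95.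
* [Rogawski1990] J. D. Rogawski, *Automorphic Representations of Unitary Groups in Three Variables*, Ann. of Math. Stud. 123 (1990): §4.9 Prop. 4.9.1 (b) pp. 54–55.
* [Serre1980Trees] J.-P. Serre, *Trees* (1980): I.6.4 Prop. 24 (displacement = twice the distance to the fixed set).
* [Kottwitz1988] R. E. Kottwitz, *Tamagawa numbers*, Ann. of Math. 127 (1988), §2.
-/

set_option autoImplicit false
-- the mandated namespace repeats the single-problem summit's segment (`HodgeConjecture.HodgeConjecture`)
set_option linter.dupNamespace false

noncomputable section

open MulAction
open scoped Valued WithZero Matrix MatrixGroups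
open Literature.NumberTheory.Automorphic Literature.NumberTheory.Automorphic.HermitianLattice Literature.NumberTheory.Automorphic.UnitaryLatticeTree
  Literature.NumberTheory.Automorphic.UnitaryGroup

namespace Summit.HodgeConjecture.HodgeConjecture.R90.S6

variable {K : Type*} [Field K] [Valued K ℤᵐ⁰] [ValuativeRel K] [(Valued.v : Valuation K ℤᵐ⁰).Compatible] {σ : K →+* K} {ϖ : K}

/-- Arithmetic of the plug-in: `N + (V₀ + V₁) = d·V + 1` and the two shell identities, solved for the shell. [folklore] -/
private theorem flickerFix_solve {S A B : ℕ} (h : S + A * 1 = A * (B * 1 + 1)) : S = A * B := by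
  have h' : A * (B * 1 + 1) = A * B + A * 1 := by ring
  omega

/-- Arithmetic of the plug-in at a vanishing column: `S + A·(0 + 1) = A·(d·0 + 1)` forces `S = 0`. [folklore] -/
private theorem flickerFix_solve_zero {S A d : ℕ} (h : S + A * 1 = A * (d * 0 + 1)) : S = 0 := by
  simp only [Nat.mul_zero, Nat.zero_add, Nat.mul_one] at h
  omega

/-! ## §1 `t₁ = t_1(a,b,c)`: `(V_hyp, V_sp) = (1, 0)` -/

-- the quotient-action instances `MulAction ↥K₀ (↥K₀ ⧸ I.subgroupOf K₀)` inside the ★ rung's binders exceed the default synthesis budget (same options as ★ `R90S6FlickerLiteralCounts`)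
set_option synthInstance.maxHeartbeats 400000 in
set_option maxHeartbeats 1600000 in
/-- **`(N′_sp, N′_hyp)(t₁) = (q³ + 1, 0)` in regime R-III**: the first displacement shells of Flicker's `t₁ = t_1(a,b,c)` with `a, b, c ∈ K¹` pairwise residually separated —
`t₁` fixes exactly the root (★ F0P2-p09 `flickerFrame_natCard_fixedBy_one_of_separated`: `(V_hyp, V_sp) = (1, 0)`), so all `q³ + 1` special neighbours of the root are moved by `2`
and no hyperspecial vertex is at displacement `2` (★ 2a `ncard_displaced_two_add_eq_of_natCard_fixedBy_eq`).  `c` any type function (`c v = 0 ↔ v` self-dual).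
[cite: Flicker1998UnitaryFL, §2 Prop. 3 pp. 78–79] [cite: Rogawski1990, §4.9 Prop. 4.9.1 (b) p. 55] [cite: Serre1980Trees, I.6.4 Prop. 24] -/
theorem flickerFix_ncard_displaced_two_tOne_separated (hd : UnramifiedLocalConjDatum σ ϖ) (hσO : ∀ x : 𝒪[K], σ x ∈ 𝒪[K]) (σk : 𝓀[K] →+* 𝓀[K])
    (hσk : ∀ x : 𝒪[K], IsLocalRing.residue 𝒪[K] ⟨σ x, hσO x⟩ = σk (IsLocalRing.residue 𝒪[K] x))
    [Fintype 𝓀[K]] {q : ℕ} (hq : Fintype.card 𝓀[K] = q ^ 2) (hfrob : ∀ y, σk y = y ^ q)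
    (g₁ : GL (Fin 3) K) (hg₁ : (g₁ : Matrix (Fin 3) (Fin 3) K) = Matrix.diagonal ![(1 : K), 1, ϖ])
    (γ : ↥(unitaryGroupOfForm σ ((StdForm.antidiagonal 3).over K)))
    [Fintype (fixedBy (↥(unitaryGroupOfForm σ ((StdForm.antidiagonal 3).over K)) ⧸
      (glInt 3 K).subgroupOf (unitaryGroupOfForm σ ((StdForm.antidiagonal 3).over K))) γ)]
    (hK₁fin : (fixedBy (↥(unitaryGroupOfForm σ ((StdForm.antidiagonal 3).over K)) ⧸
      ((glInt 3 K).map (MulAut.conj g₁).toMonoidHom).subgroupOf (unitaryGroupOfForm σ ((StdForm.antidiagonal 3).over K))) γ).Finite)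
    (horb : (Set.range fun n : ℕ => ((γ ^ n : ↥(unitaryGroupOfForm σ ((StdForm.antidiagonal 3).over K))) :
      ↥(unitaryGroupOfForm σ ((StdForm.antidiagonal 3).over K)) ⧸ (glInt 3 K).subgroupOf (unitaryGroupOfForm σ ((StdForm.antidiagonal 3).over K)))).Finite)
    (r : ↥(unitaryGroupOfForm σ ((StdForm.antidiagonal 3).over K)) ⧸ (glInt 3 K).subgroupOf (unitaryGroupOfForm σ ((StdForm.antidiagonal 3).over K)) →
      ↥(unitaryGroupOfForm σ ((StdForm.antidiagonal 3).over K)))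
    (hr : Function.RightInverse r QuotientGroup.mk)
    [∀ x : fixedBy (↥(unitaryGroupOfForm σ ((StdForm.antidiagonal 3).over K)) ⧸
        (glInt 3 K).subgroupOf (unitaryGroupOfForm σ ((StdForm.antidiagonal 3).over K))) γ,
      Finite (fixedBy (↥((glInt 3 K).subgroupOf (unitaryGroupOfForm σ ((StdForm.antidiagonal 3).over K))) ⧸
        (((glInt 3 K).subgroupOf (unitaryGroupOfForm σ ((StdForm.antidiagonal 3).over K)) ⊓
          ((glInt 3 K).map (MulAut.conj g₁).toMonoidHom).subgroupOf (unitaryGroupOfForm σ ((StdForm.antidiagonal 3).over K))).subgroupOf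
          ((glInt 3 K).subgroupOf (unitaryGroupOfForm σ ((StdForm.antidiagonal 3).over K)))))
        (⟨(r x.1)⁻¹ * γ * r x.1, inv_mul_mul_mem_of_smul_eq r hr γ x.2⟩ :
          ↥((glInt 3 K).subgroupOf (unitaryGroupOfForm σ ((StdForm.antidiagonal 3).over K)))))]
    (c : {M : Submodule 𝒪[K] (Fin 3 → K) // IsVertex σ ϖ ((StdForm.antidiagonal 3).over K) M} → Fin 2)
    (hc0 : ∀ v, c v = 0 ↔ IsSelfDualLattice σ ϖ ((StdForm.antidiagonal 3).over K) v.1)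
    {e a b cc : K} (h2 : Valued.v (2 : K) = 1) (h2e : 2 * e = 1) (ha : σ a * a = 1) (hb : σ b * b = 1) (hcc : σ cc * cc = 1)
    (hab : Valued.v (a - b) = 1) (hac : Valued.v (a - cc) = 1) (hbc : Valued.v (b - cc) = 1)
    (hγ : ((γ : GL (Fin 3) K) : Matrix (Fin 3) (Fin 3) K) = !![e * (a + cc), 0, -(e * (a - cc)); 0, b, 0; -(e * (a - cc)), 0, e * (a + cc)]) :
    {x : {M : Submodule 𝒪[K] (Fin 3 → K) // IsVertex σ ϖ ((StdForm.antidiagonal 3).over K) M} |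
        (latticeGraph σ ϖ ((StdForm.antidiagonal 3).over K)).dist x (latticeGraphIso σ ϖ ((StdForm.antidiagonal 3).over K) γ x) = 2 ∧ c x = 1}.ncard = q ^ 3 + 1 ∧
      {x : {M : Submodule 𝒪[K] (Fin 3 → K) // IsVertex σ ϖ ((StdForm.antidiagonal 3).over K) M} |
        (latticeGraph σ ϖ ((StdForm.antidiagonal 3).over K)).dist x (latticeGraphIso σ ϖ ((StdForm.antidiagonal 3).over K) γ x) = 2 ∧ c x = 0}.ncard = 0 := by
  obtain ⟨hV₀, hV₁⟩ := flickerFrame_natCard_fixedBy_one_of_separated hd g₁ hg₁ γ hK₁fin horb r hr h2 h2e ha hb hcc hab hac hbc hγ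
  obtain ⟨h1, h0⟩ := ncard_displaced_two_add_eq_of_natCard_fixedBy_eq hd hσO σk hσk hq hfrob g₁ hg₁ γ hK₁fin horb c hc0 hV₀ hV₁
  constructor <;> omega

-- the quotient-action instances `MulAction ↥K₀ (↥K₀ ⧸ I.subgroupOf K₀)` inside the ★ rung's binders exceed the default synthesis budget (same options as ★ `R90S6FlickerLiteralCounts`)
set_option synthInstance.maxHeartbeats 400000 in
set_option maxHeartbeats 1600000 in
/-- **`S′_k(t₁) = q^{2k−3}(q³+1)` (`k` even) ∕ `0` (`k` odd) in regime R-III** (`k ≥ 1`): all hyperspecial displacement shells `#{x self-dual : d(x, t₁x) = 2k}` of Flicker's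
`t₁` with separated residues — ★ 2a `ncard_selfDual_displaced_add_eq_of_natCard_fixedBy_eq` (★ G3-NUMBERS growth law) at `(V_hyp, V_sp) = (1, 0)`; these are ★ A1's
`O_{t₁}(1_{K₀ t^k K₀}) ∕ ν(K₀)` (hand check (iii) of the (E1) sheet: `S′₂(t₁) = (q³+1)·q`). [cite: Rogawski1990, §4.9 Prop. 4.9.1 (b) pp. 54–55] [cite: Serre1980Trees, I.6.4 Prop. 24]
[cite: Flicker1998UnitaryFL, §6 p. 95] -/
theorem flickerFix_ncard_selfDual_displaced_tOne_separated (hd : UnramifiedLocalConjDatum σ ϖ) (hσO : ∀ x : 𝒪[K], σ x ∈ 𝒪[K]) (σk : 𝓀[K] →+* 𝓀[K])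
    (hσk : ∀ x : 𝒪[K], IsLocalRing.residue 𝒪[K] ⟨σ x, hσO x⟩ = σk (IsLocalRing.residue 𝒪[K] x))
    [Fintype 𝓀[K]] {q : ℕ} (hq : Fintype.card 𝓀[K] = q ^ 2) (hfrob : ∀ y, σk y = y ^ q)
    (g₁ : GL (Fin 3) K) (hg₁ : (g₁ : Matrix (Fin 3) (Fin 3) K) = Matrix.diagonal ![(1 : K), 1, ϖ])
    (γ : ↥(unitaryGroupOfForm σ ((StdForm.antidiagonal 3).over K)))
    [Fintype (fixedBy (↥(unitaryGroupOfForm σ ((StdForm.antidiagonal 3).over K)) ⧸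
      (glInt 3 K).subgroupOf (unitaryGroupOfForm σ ((StdForm.antidiagonal 3).over K))) γ)]
    (hK₁fin : (fixedBy (↥(unitaryGroupOfForm σ ((StdForm.antidiagonal 3).over K)) ⧸
      ((glInt 3 K).map (MulAut.conj g₁).toMonoidHom).subgroupOf (unitaryGroupOfForm σ ((StdForm.antidiagonal 3).over K))) γ).Finite)
    (horb : (Set.range fun n : ℕ => ((γ ^ n : ↥(unitaryGroupOfForm σ ((StdForm.antidiagonal 3).over K))) :
      ↥(unitaryGroupOfForm σ ((StdForm.antidiagonal 3).over K)) ⧸ (glInt 3 K).subgroupOf (unitaryGroupOfForm σ ((StdForm.antidiagonal 3).over K)))).Finite)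
    (r : ↥(unitaryGroupOfForm σ ((StdForm.antidiagonal 3).over K)) ⧸ (glInt 3 K).subgroupOf (unitaryGroupOfForm σ ((StdForm.antidiagonal 3).over K)) →
      ↥(unitaryGroupOfForm σ ((StdForm.antidiagonal 3).over K)))
    (hr : Function.RightInverse r QuotientGroup.mk)
    [∀ x : fixedBy (↥(unitaryGroupOfForm σ ((StdForm.antidiagonal 3).over K)) ⧸
        (glInt 3 K).subgroupOf (unitaryGroupOfForm σ ((StdForm.antidiagonal 3).over K))) γ,
      Finite (fixedBy (↥((glInt 3 K).subgroupOf (unitaryGroupOfForm σ ((StdForm.antidiagonal 3).over K))) ⧸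
        (((glInt 3 K).subgroupOf (unitaryGroupOfForm σ ((StdForm.antidiagonal 3).over K)) ⊓
          ((glInt 3 K).map (MulAut.conj g₁).toMonoidHom).subgroupOf (unitaryGroupOfForm σ ((StdForm.antidiagonal 3).over K))).subgroupOf
          ((glInt 3 K).subgroupOf (unitaryGroupOfForm σ ((StdForm.antidiagonal 3).over K)))))
        (⟨(r x.1)⁻¹ * γ * r x.1, inv_mul_mul_mem_of_smul_eq r hr γ x.2⟩ :
          ↥((glInt 3 K).subgroupOf (unitaryGroupOfForm σ ((StdForm.antidiagonal 3).over K)))))]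
    {e a b cc : K} (h2 : Valued.v (2 : K) = 1) (h2e : 2 * e = 1) (ha : σ a * a = 1) (hb : σ b * b = 1) (hcc : σ cc * cc = 1)
    (hab : Valued.v (a - b) = 1) (hac : Valued.v (a - cc) = 1) (hbc : Valued.v (b - cc) = 1)
    (hγ : ((γ : GL (Fin 3) K) : Matrix (Fin 3) (Fin 3) K) = !![e * (a + cc), 0, -(e * (a - cc)); 0, b, 0; -(e * (a - cc)), 0, e * (a + cc)])
    (k : ℕ) (hk : 1 ≤ k) :
    {x : {M : Submodule 𝒪[K] (Fin 3 → K) // IsVertex σ ϖ ((StdForm.antidiagonal 3).over K) M} |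
        IsSelfDualLattice σ ϖ ((StdForm.antidiagonal 3).over K) x.1 ∧
          (latticeGraph σ ϖ ((StdForm.antidiagonal 3).over K)).dist x
            (latticeGraphPerm σ ϖ ((StdForm.antidiagonal 3).over K) γ x) = 2 * k}.ncard =
      if Even k then q ^ (2 * k - 3) * (q ^ 3 + 1) else 0 := by
  obtain ⟨hV₀, hV₁⟩ := flickerFrame_natCard_fixedBy_one_of_separated hd g₁ hg₁ γ hK₁fin horb r hr h2 h2e ha hb hcc hab hac hbc hγ
  have h := ncard_selfDual_displaced_add_eq_of_natCard_fixedBy_eq hd hσO σk hσk hq hfrob g₁ hg₁ γ hK₁fin horb hV₀ hV₁ k hk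
  split_ifs at h ⊢ with he
  · exact flickerFix_solve h
  · exact flickerFix_solve_zero h

/-! ## §2 `t_ϖ(a,b,c)`: `(V_hyp, V_sp) = (0, 1)` -/

-- the quotient-action instances `MulAction ↥K₀ (↥K₀ ⧸ I.subgroupOf K₀)` inside the ★ rung's binders exceed the default synthesis budget (same options as ★ `R90S6FlickerLiteralCounts`)
set_option synthInstance.maxHeartbeats 400000 in
set_option maxHeartbeats 1600000 in
/-- **`(N′_sp, N′_hyp)(t_ϖ(a,b,c)) = (0, q + 1)` in regime R-III**: Flicker's `t_ϖ` fixes exactly one special vertex (★ F0P2-p09 `flickerFrame_natCard_fixedBy_pi_of_separated`: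
`(V_hyp, V_sp) = (0, 1)`), whose `q + 1` hyperspecial neighbours are all moved by `2`, and no special vertex is at displacement `2` (★ 2a `ncard_displaced_two_add_eq_of_natCard_fixedBy_eq`).
[cite: Flicker1998UnitaryFL, §3 p. 80] [cite: Rogawski1990, §4.9 Prop. 4.9.1 (b) p. 55] [cite: Serre1980Trees, I.6.4 Prop. 24] -/
theorem flickerFix_ncard_displaced_two_tpi_separated (hd : UnramifiedLocalConjDatum σ ϖ) (hσO : ∀ x : 𝒪[K], σ x ∈ 𝒪[K]) (σk : 𝓀[K] →+* 𝓀[K])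
    (hσk : ∀ x : 𝒪[K], IsLocalRing.residue 𝒪[K] ⟨σ x, hσO x⟩ = σk (IsLocalRing.residue 𝒪[K] x))
    [Fintype 𝓀[K]] {q : ℕ} (hq : Fintype.card 𝓀[K] = q ^ 2) (hfrob : ∀ y, σk y = y ^ q)
    (g₁ : GL (Fin 3) K) (hg₁ : (g₁ : Matrix (Fin 3) (Fin 3) K) = Matrix.diagonal ![(1 : K), 1, ϖ])
    (γ : ↥(unitaryGroupOfForm σ ((StdForm.antidiagonal 3).over K)))
    [Fintype (fixedBy (↥(unitaryGroupOfForm σ ((StdForm.antidiagonal 3).over K)) ⧸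
      (glInt 3 K).subgroupOf (unitaryGroupOfForm σ ((StdForm.antidiagonal 3).over K))) γ)]
    (hK₁fin : (fixedBy (↥(unitaryGroupOfForm σ ((StdForm.antidiagonal 3).over K)) ⧸
      ((glInt 3 K).map (MulAut.conj g₁).toMonoidHom).subgroupOf (unitaryGroupOfForm σ ((StdForm.antidiagonal 3).over K))) γ).Finite)
    (horb : (Set.range fun n : ℕ => ((γ ^ n : ↥(unitaryGroupOfForm σ ((StdForm.antidiagonal 3).over K))) :
      ↥(unitaryGroupOfForm σ ((StdForm.antidiagonal 3).over K)) ⧸ (glInt 3 K).subgroupOf (unitaryGroupOfForm σ ((StdForm.antidiagonal 3).over K)))).Finite)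
    (r : ↥(unitaryGroupOfForm σ ((StdForm.antidiagonal 3).over K)) ⧸ (glInt 3 K).subgroupOf (unitaryGroupOfForm σ ((StdForm.antidiagonal 3).over K)) →
      ↥(unitaryGroupOfForm σ ((StdForm.antidiagonal 3).over K)))
    (hr : Function.RightInverse r QuotientGroup.mk)
    [∀ x : fixedBy (↥(unitaryGroupOfForm σ ((StdForm.antidiagonal 3).over K)) ⧸
        (glInt 3 K).subgroupOf (unitaryGroupOfForm σ ((StdForm.antidiagonal 3).over K))) γ,
      Finite (fixedBy (↥((glInt 3 K).subgroupOf (unitaryGroupOfForm σ ((StdForm.antidiagonal 3).over K))) ⧸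
        (((glInt 3 K).subgroupOf (unitaryGroupOfForm σ ((StdForm.antidiagonal 3).over K)) ⊓
          ((glInt 3 K).map (MulAut.conj g₁).toMonoidHom).subgroupOf (unitaryGroupOfForm σ ((StdForm.antidiagonal 3).over K))).subgroupOf
          ((glInt 3 K).subgroupOf (unitaryGroupOfForm σ ((StdForm.antidiagonal 3).over K)))))
        (⟨(r x.1)⁻¹ * γ * r x.1, inv_mul_mul_mem_of_smul_eq r hr γ x.2⟩ :
          ↥((glInt 3 K).subgroupOf (unitaryGroupOfForm σ ((StdForm.antidiagonal 3).over K)))))]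
    (c : {M : Submodule 𝒪[K] (Fin 3 → K) // IsVertex σ ϖ ((StdForm.antidiagonal 3).over K) M} → Fin 2)
    (hc0 : ∀ v, c v = 0 ↔ IsSelfDualLattice σ ϖ ((StdForm.antidiagonal 3).over K) v.1)
    {e a b cc : K} (h2 : Valued.v (2 : K) = 1) (h2e : 2 * e = 1) (ha : σ a * a = 1) (hb : σ b * b = 1) (hcc : σ cc * cc = 1)
    (hab : Valued.v (a - b) = 1) (hac : Valued.v (a - cc) = 1) (hbc : Valued.v (b - cc) = 1)
    (hγ : ((γ : GL (Fin 3) K) : Matrix (Fin 3) (Fin 3) K) =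
      !![e * (a + cc), 0, -(e * (a - cc) * ϖ); 0, b, 0; -(e * (a - cc) * ϖ⁻¹), 0, e * (a + cc)]) :
    {x : {M : Submodule 𝒪[K] (Fin 3 → K) // IsVertex σ ϖ ((StdForm.antidiagonal 3).over K) M} |
        (latticeGraph σ ϖ ((StdForm.antidiagonal 3).over K)).dist x (latticeGraphIso σ ϖ ((StdForm.antidiagonal 3).over K) γ x) = 2 ∧ c x = 1}.ncard = 0 ∧
      {x : {M : Submodule 𝒪[K] (Fin 3 → K) // IsVertex σ ϖ ((StdForm.antidiagonal 3).over K) M} |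
        (latticeGraph σ ϖ ((StdForm.antidiagonal 3).over K)).dist x (latticeGraphIso σ ϖ ((StdForm.antidiagonal 3).over K) γ x) = 2 ∧ c x = 0}.ncard = q + 1 := by
  obtain ⟨hV₀, hV₁⟩ := flickerFrame_natCard_fixedBy_pi_of_separated hd g₁ hg₁ γ hK₁fin horb r hr h2 h2e ha hb hcc hab hac hbc hγ
  obtain ⟨h1, h0⟩ := ncard_displaced_two_add_eq_of_natCard_fixedBy_eq hd hσO σk hσk hq hfrob g₁ hg₁ γ hK₁fin horb c hc0 hV₀ hV₁
  constructor <;> omega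

-- the quotient-action instances `MulAction ↥K₀ (↥K₀ ⧸ I.subgroupOf K₀)` inside the ★ rung's binders exceed the default synthesis budget (same options as ★ `R90S6FlickerLiteralCounts`)
set_option synthInstance.maxHeartbeats 400000 in
set_option maxHeartbeats 1600000 in
/-- **`S′_k(t_ϖ(a,b,c)) = 0` (`k` even) ∕ `q^{2(k−1)}(q+1)` (`k` odd) in regime R-III** (`k ≥ 1`): all hyperspecial displacement shells of Flicker's `t_ϖ` with separated residues —
★ 2a `ncard_selfDual_displaced_add_eq_of_natCard_fixedBy_eq` at `(V_hyp, V_sp) = (0, 1)` (hand checks (ii) `S′₁ = q+1`, (iii) `S′₂ = 0` of the (E1) sheet).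
[cite: Rogawski1990, §4.9 Prop. 4.9.1 (b) pp. 54–55] [cite: Serre1980Trees, I.6.4 Prop. 24] [cite: Flicker1998UnitaryFL, §6 p. 95] -/
theorem flickerFix_ncard_selfDual_displaced_tpi_separated (hd : UnramifiedLocalConjDatum σ ϖ) (hσO : ∀ x : 𝒪[K], σ x ∈ 𝒪[K]) (σk : 𝓀[K] →+* 𝓀[K])
    (hσk : ∀ x : 𝒪[K], IsLocalRing.residue 𝒪[K] ⟨σ x, hσO x⟩ = σk (IsLocalRing.residue 𝒪[K] x))
    [Fintype 𝓀[K]] {q : ℕ} (hq : Fintype.card 𝓀[K] = q ^ 2) (hfrob : ∀ y, σk y = y ^ q)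
    (g₁ : GL (Fin 3) K) (hg₁ : (g₁ : Matrix (Fin 3) (Fin 3) K) = Matrix.diagonal ![(1 : K), 1, ϖ])
    (γ : ↥(unitaryGroupOfForm σ ((StdForm.antidiagonal 3).over K)))
    [Fintype (fixedBy (↥(unitaryGroupOfForm σ ((StdForm.antidiagonal 3).over K)) ⧸
      (glInt 3 K).subgroupOf (unitaryGroupOfForm σ ((StdForm.antidiagonal 3).over K))) γ)]
    (hK₁fin : (fixedBy (↥(unitaryGroupOfForm σ ((StdForm.antidiagonal 3).over K)) ⧸
      ((glInt 3 K).map (MulAut.conj g₁).toMonoidHom).subgroupOf (unitaryGroupOfForm σ ((StdForm.antidiagonal 3).over K))) γ).Finite)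
    (horb : (Set.range fun n : ℕ => ((γ ^ n : ↥(unitaryGroupOfForm σ ((StdForm.antidiagonal 3).over K))) :
      ↥(unitaryGroupOfForm σ ((StdForm.antidiagonal 3).over K)) ⧸ (glInt 3 K).subgroupOf (unitaryGroupOfForm σ ((StdForm.antidiagonal 3).over K)))).Finite)
    (r : ↥(unitaryGroupOfForm σ ((StdForm.antidiagonal 3).over K)) ⧸ (glInt 3 K).subgroupOf (unitaryGroupOfForm σ ((StdForm.antidiagonal 3).over K)) →
      ↥(unitaryGroupOfForm σ ((StdForm.antidiagonal 3).over K)))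
    (hr : Function.RightInverse r QuotientGroup.mk)
    [∀ x : fixedBy (↥(unitaryGroupOfForm σ ((StdForm.antidiagonal 3).over K)) ⧸
        (glInt 3 K).subgroupOf (unitaryGroupOfForm σ ((StdForm.antidiagonal 3).over K))) γ,
      Finite (fixedBy (↥((glInt 3 K).subgroupOf (unitaryGroupOfForm σ ((StdForm.antidiagonal 3).over K))) ⧸
        (((glInt 3 K).subgroupOf (unitaryGroupOfForm σ ((StdForm.antidiagonal 3).over K)) ⊓
          ((glInt 3 K).map (MulAut.conj g₁).toMonoidHom).subgroupOf (unitaryGroupOfForm σ ((StdForm.antidiagonal 3).over K))).subgroupOf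
          ((glInt 3 K).subgroupOf (unitaryGroupOfForm σ ((StdForm.antidiagonal 3).over K)))))
        (⟨(r x.1)⁻¹ * γ * r x.1, inv_mul_mul_mem_of_smul_eq r hr γ x.2⟩ :
          ↥((glInt 3 K).subgroupOf (unitaryGroupOfForm σ ((StdForm.antidiagonal 3).over K)))))]
    {e a b cc : K} (h2 : Valued.v (2 : K) = 1) (h2e : 2 * e = 1) (ha : σ a * a = 1) (hb : σ b * b = 1) (hcc : σ cc * cc = 1)
    (hab : Valued.v (a - b) = 1) (hac : Valued.v (a - cc) = 1) (hbc : Valued.v (b - cc) = 1)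
    (hγ : ((γ : GL (Fin 3) K) : Matrix (Fin 3) (Fin 3) K) =
      !![e * (a + cc), 0, -(e * (a - cc) * ϖ); 0, b, 0; -(e * (a - cc) * ϖ⁻¹), 0, e * (a + cc)])
    (k : ℕ) (hk : 1 ≤ k) :
    {x : {M : Submodule 𝒪[K] (Fin 3 → K) // IsVertex σ ϖ ((StdForm.antidiagonal 3).over K) M} |
        IsSelfDualLattice σ ϖ ((StdForm.antidiagonal 3).over K) x.1 ∧
          (latticeGraph σ ϖ ((StdForm.antidiagonal 3).over K)).dist x
            (latticeGraphPerm σ ϖ ((StdForm.antidiagonal 3).over K) γ x) = 2 * k}.ncard =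
      if Even k then 0 else q ^ (2 * (k - 1)) * (q + 1) := by
  obtain ⟨hV₀, hV₁⟩ := flickerFrame_natCard_fixedBy_pi_of_separated hd g₁ hg₁ γ hK₁fin horb r hr h2 h2e ha hb hcc hab hac hbc hγ
  have h := ncard_selfDual_displaced_add_eq_of_natCard_fixedBy_eq hd hσO σk hσk hq hfrob g₁ hg₁ γ hK₁fin horb hV₀ hV₁ k hk
  split_ifs at h ⊢ with he
  · exact flickerFix_solve_zero (by simpa only [Nat.zero_add] using h)
  · exact flickerFix_solve (by simpa only [Nat.zero_add] using h)

end Summit.HodgeConjecture.HodgeConjecture.R90.S6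

end
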